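import Summits.NavierStokesRegularity.OSWSelfSimilar.SheetREvenPairOperator
import Summits.NavierStokesRegularity.OSWSelfSimilar.SheetRCutoffApproximation
import HarnessLib

/-!
# SHEET-ℝ frame, EVEN ZERO-MASS class `E⁺₀` — dictionary layer 4a: the MASS-CORRECTED cutoff tests `σ_R = χ_R u − (∫χ_R u)·ρ` of an even
# zero-mass profile, their energy-norm convergence, the plateau identities against the bump, and the bilinear expansion of the form

HONEST FRAMING (cell ns-blowup GROUP B / zone Z3, case Z3-SR-SPEC EVEN half; 1-D MODEL certificate frame (viscous gCLM/OSW sheet on the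
line); not Euler/NS; «violates: none — MODEL»).  Nothing here asserts that a profile exists; no number of record moves.

In the odd class the cutoffs `χ_R u` of an energy-space profile ARE tests, and the Gaffney-type cutoff argument
(`SheetRLinearisedCutoffEnergy`, `SheetRCutoffApproximation`, `SheetRPerturbedUniqueness`) runs on them.  In the even ZERO-MASS class
(DESIGN-Z3-SR-SPEC-EVEN (D1)) `χ_R u` is an even test but NOT zero-mass, so coercivity (the (S1⁺) datum, stated on zero-mass tests) is applied
to the mass-corrected test `σ_R := χ_R u − μ_R·ρ`, `μ_R = ∫χ_R u → ∫u = 0` (`ρ` = the normalised bump of `SheetREvenTestsBump`).  This file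
supplies the pieces of that argument which do not involve the weak equation:

* `pairW` — the `L²_w × L²_w` pair `(½[v], [v₁])` of a parity-free test (`= jmapE` on zero-mass tests), its components and norms, and
  `pairW_sub_smul_bump` (`pairW σ_R = pairW(χ_R u) − μ_R·pairW ρ`);
* `sq_norm_pairW_cutoff_sub_le` — `‖pairW(χ_R u) − p‖² ≤ (¼ + 2M²)∫_{R²≤ξ²}wu² + 2∫_{R²≤ξ²}wu₁²` (twin of
  `SheetRCutoffApproximation.sq_norm_jmap_cutoff_sub_le`);
* `bump_support_two`, `linForm_cutoff_bump_eq` / `linForm_bump_cutoff_eq` — for `R ≥ 2` the bump sits inside the plateau, so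
  `linForm(χ_R u; ρ) = linForm(u; ρ)` and `linForm(ρ; χ_R u) = linForm(ρ; u)` EXACTLY;
* `linForm_sub_smul_expand` — `linForm(a − μb; a − μb) = linForm(a;a) − μ·linForm(a;b) − μ·linForm(b;a) + μ²·linForm(b;b)` for parity-free
  tests `a, b` in the weighted class;
* `garding_shiftE` — the (S1⁺) datum at the shifted potential: `c‖v₁‖²_w + (m + s)‖v‖²_w ≤ linForm_{V+s}(v; v) + ∫ w K(jmapE v)·v`.
One definition (`pairW`); no named fact.  WHAT THIS IS NOT: not NS.
-/

noncomputable section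

namespace Summit.NavierStokesRegularity.OSWSelfSimilar
namespace SheetREvenCutoff

open _root_.MeasureTheory _root_.Set _root_.Filter _root_.Real SheetRWeakProfilePV SheetRWeakToStrong SheetREnergyClass SheetRWeightedMeasure
  SheetRLinearisedTests SheetREnergySpace SheetRTestSpace SheetRLinearisedFormBounds SheetREvenTests SheetREvenEnergySpace SheetREvenForms
  SheetRCutoffApproximation
open scoped Topology ENNReal

variable {L : ℝ}

/-! ### §1 The `L²_w × L²_w` pair of a parity-free test -/

/-- **The pair `(½[v], [v₁]) ∈ L²_w × L²_w` of a parity-free test** (for a zero-mass even test this IS `jmapE`, coerced). [folklore] -/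
def pairW (L : ℝ) {v v₁ : ℝ → ℝ} (hv : IsCompactTestAny v v₁) : WithLp 2 (W L × W L) :=
  WithLp.toLp 2 (((1 / 2 : ℝ) • (memLp_W_of_any (L := L) hv).1.toLp v), (memLp_W_of_any (L := L) hv).2.toLp v₁)

/-- `jmapE vp`, coerced to `W L × W L`, is `pairW` of the underlying test. [folklore] -/
theorem coe_jmapE (hL : 0 < L) (vp : testSpaceE0) :
    ((jmapE hL vp : EspE L hL) : WithLp 2 (W L × W L)) = pairW L vp.2.1.toIsCompactTestAny := rfl

/-- Components of `pairW` as functions, a.e.: `fst = ½v`, `snd = v₁`. [folklore] -/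
theorem pairW_ae (hL : 0 < L) {v v₁ : ℝ → ℝ} (hv : IsCompactTestAny v v₁) :
    ((((pairW L hv).fst : W L) : ℝ → ℝ) =ᵐ[volume] fun y => 1 / 2 * v y) ∧
      ((((pairW L hv).snd : W L) : ℝ → ℝ) =ᵐ[volume] v₁) := by
  have hae_a : (((memLp_W_of_any (L := L) hv).1.toLp v : W L) : ℝ → ℝ) =ᵐ[volume] v := ae_volume_of_ae_μw hL (MemLp.coeFn_toLp _)
  have hae_b : (((memLp_W_of_any (L := L) hv).2.toLp v₁ : W L) : ℝ → ℝ) =ᵐ[volume] v₁ := ae_volume_of_ae_μw hL (MemLp.coeFn_toLp _)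
  refine ⟨?_, hae_b⟩
  have h1 : (((1 / 2 : ℝ) • (memLp_W_of_any (L := L) hv).1.toLp v : W L) : ℝ → ℝ) =ᵐ[volume]
      fun y => (1 / 2) * (((memLp_W_of_any (L := L) hv).1.toLp v : W L) : ℝ → ℝ) y :=
    (ae_volume_of_ae_μw hL (Lp.coeFn_smul (1 / 2 : ℝ) _)).mono fun y hy => by rw [hy, Pi.smul_apply, smul_eq_mul]
  exact h1.trans (hae_a.mono fun y hy => by simp only [hy])

/-- Norms of the components of `pairW`: `‖fst‖² = ¼∫wv²`, `‖snd‖² = ∫wv₁²`. [folklore] -/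
theorem sq_norm_pairW (hL : 0 < L) {v v₁ : ℝ → ℝ} (hv : IsCompactTestAny v v₁) :
    ‖(pairW L hv).fst‖ ^ 2 = 1 / 4 * ∫ y, (L ^ 2 + y ^ 2) * v y ^ 2 ∧ ‖(pairW L hv).snd‖ ^ 2 = ∫ y, (L ^ 2 + y ^ 2) * v₁ y ^ 2 := by
  obtain ⟨h1, h2⟩ := pairW_ae hL hv
  refine ⟨?_, ?_⟩
  · rw [sq_norm_W, ← integral_const_mul]
    exact integral_congr_ae (h1.mono fun y hy => by simp only [hy]; ring)
  · rw [sq_norm_W]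
    exact integral_congr_ae (h2.mono fun y hy => by simp only [hy])

/-- **`pairW` of the mass-corrected test**: `pairW(v − μρ, v₁ − μρ₁) = pairW(v, v₁) − μ·pairW(ρ, ρ₁)`. [folklore] -/
theorem pairW_sub_smul_bump (L : ℝ) {v v₁ : ℝ → ℝ} (hv : IsCompactTestAny v v₁) (μ : ℝ)
    (hσ : IsCompactTestAny (v - μ • bumpFun) (v₁ - μ • bumpDeriv)) :
    pairW L hσ = pairW L hv - μ • pairW L isCompactTestE_bump.toIsCompactTestAny := by
  have hb := isCompactTestE_bump.toIsCompactTestAny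
  have h1 : ((memLp_W_of_any (L := L) hσ).1.toLp (v - μ • bumpFun) : W L) =
      (memLp_W_of_any (L := L) hv).1.toLp v - μ • (memLp_W_of_any (L := L) hb).1.toLp bumpFun := by
    rw [← MemLp.toLp_const_smul, ← MemLp.toLp_sub]
  have h2 : ((memLp_W_of_any (L := L) hσ).2.toLp (v₁ - μ • bumpDeriv) : W L) =
      (memLp_W_of_any (L := L) hv).2.toLp v₁ - μ • (memLp_W_of_any (L := L) hb).2.toLp bumpDeriv := by
    rw [← MemLp.toLp_const_smul, ← MemLp.toLp_sub]
  simp only [pairW]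
  rw [h1, h2, ← WithLp.toLp_smul, ← WithLp.toLp_sub, Prod.smul_mk, Prod.mk_sub_mk, smul_sub, smul_comm (1 / 2 : ℝ) μ]

/-! ### §2 The cutoffs of an even energy-space profile approximate it in the energy norm -/

/-- **Energy-norm cutoff approximation (even class).** For `p ∈ EspE` with profile `u = profile p`, `u₁ = derE p`, `R ≥ 1`, `|χ_R′| ≤ M/R`:
`‖pairW(χ_R u, χ_R′u + χ_R u₁) − p‖² ≤ (¼ + 2M²)·∫_{R²≤ξ²} w u² + 2·∫_{R²≤ξ²} w u₁²`. [folklore] -/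
theorem sq_norm_pairW_cutoff_sub_le (hL : 0 < L) (p : EspE L hL) {R M : ℝ} (hR : 1 ≤ R) (hM0 : 0 ≤ M)
    (hM : ∀ ξ : ℝ, |deriv (cutoff R) ξ| ≤ M / R)
    (hτ : IsCompactTestAny (fun ξ => cutoff R ξ * profile p ξ) (fun ξ => deriv (cutoff R) ξ * profile p ξ + cutoff R ξ * derE p ξ)) :
    ‖pairW L hτ - (p : WithLp 2 (W L × W L))‖ ^ 2 ≤
      (1 / 4 + 2 * M ^ 2) * (∫ y in {ξ : ℝ | R ^ 2 ≤ ξ ^ 2}, (L ^ 2 + y ^ 2) * profile p y ^ 2)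
        + 2 * ∫ y in {ξ : ℝ | R ^ 2 ≤ ξ ^ 2}, (L ^ 2 + y ^ 2) * derE p y ^ 2 := by
  have hR0 : 0 < R := by linarith
  obtain ⟨hum, hu₁m, h0, h1, -, -⟩ := profileE_facts hL p
  set P : WithLp 2 (W L × W L) := (p : WithLp 2 (W L × W L)) with hP
  obtain ⟨ha1, ha2⟩ := pairW_ae hL hτ
  have hn : ‖pairW L hτ - P‖ ^ 2 = ‖((pairW L hτ - P).fst : W L)‖ ^ 2 + ‖((pairW L hτ - P).snd : W L)‖ ^ 2 := by
    rw [← WithLp.prod_norm_sq_eq_of_L2]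
  have hfst_ae : ((((pairW L hτ - P).fst : W L)) : ℝ → ℝ) =ᵐ[volume] fun y => -(1 / 2) * ((1 - cutoff R y) * profile p y) := by
    rw [WithLp.sub_fst]
    filter_upwards [ae_volume_of_ae_μw hL (Lp.coeFn_sub ((pairW L hτ).fst : W L) (P.fst : W L)), ha1, profile_ae_eq hL p]
      with y hs h1' hp
    rw [hs, Pi.sub_apply, h1']
    have : ((P.fst : W L) : ℝ → ℝ) y = 1 / 2 * profile p y := by rw [hP]; linarith
    rw [this]; ring
  have hsnd_ae : ((((pairW L hτ - P).snd : W L)) : ℝ → ℝ) =ᵐ[volume]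
      fun y => deriv (cutoff R) y * profile p y + -((1 - cutoff R y) * derE p y) := by
    rw [WithLp.sub_snd]
    filter_upwards [ae_volume_of_ae_μw hL (Lp.coeFn_sub ((pairW L hτ).snd : W L) (P.snd : W L)), ha2] with y hs h2'
    rw [hs, Pi.sub_apply, h2', hP, derE_def]; ring
  obtain ⟨hi0, hle0⟩ := weightedSq_one_sub_cutoff_mul_le (L := L) hR0 hum h0
  obtain ⟨hi1, hle1⟩ := weightedSq_one_sub_cutoff_mul_le (L := L) hR0 hu₁m h1
  obtain ⟨hid, hled⟩ := weightedSq_deriv_cutoff_mul_le (L := L) hR hM0 hM hum h0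
  have hfst : ‖((pairW L hτ - P).fst : W L)‖ ^ 2 = 1 / 4 * ∫ y, (L ^ 2 + y ^ 2) * ((1 - cutoff R y) * profile p y) ^ 2 := by
    rw [sq_norm_W, ← integral_const_mul]
    refine integral_congr_ae (hfst_ae.mono fun y hy => ?_)
    simp only [hy]; ring
  have hsnd : ‖((pairW L hτ - P).snd : W L)‖ ^ 2 ≤
      2 * (∫ y, (L ^ 2 + y ^ 2) * (deriv (cutoff R) y * profile p y) ^ 2) + 2 * ∫ y, (L ^ 2 + y ^ 2) * ((1 - cutoff R y) * derE p y) ^ 2 := by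
    rw [sq_norm_W, ← integral_const_mul, ← integral_const_mul, ← integral_add (hid.const_mul 2) (hi1.const_mul 2)]
    refine integral_mono_ae (weightedSq_of_W hL _) ((hid.const_mul 2).add (hi1.const_mul 2)) (hsnd_ae.mono fun y hy => ?_)
    simp only [hy]
    have hw : 0 ≤ L ^ 2 + y ^ 2 := by positivity
    nlinarith [mul_nonneg hw (sq_nonneg (deriv (cutoff R) y * profile p y + (1 - cutoff R y) * derE p y)),
      mul_nonneg hw (sq_nonneg (deriv (cutoff R) y * profile p y - (1 - cutoff R y) * derE p y))]
  rw [hn, hfst]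
  have hnn : 0 ≤ ∫ y, (L ^ 2 + y ^ 2) * ((1 - cutoff R y) * profile p y) ^ 2 := integral_nonneg fun y => by positivity
  nlinarith [hle0, hle1, hled]

/-! ### §3 The bump sits inside the plateau: exact identities for `R ≥ 2` -/

/-- The bump and its derivative vanish where `2 ≤ |ξ|`. [folklore] -/
theorem bump_support_two (x : ℝ) (hx : 2 ≤ |x|) : bumpFun x = 0 ∧ bumpDeriv x = 0 := by
  have h2 : 2 * (1 : ℝ) ≤ |x| := by linarith
  obtain ⟨h1, h2⟩ := cutoff_and_deriv_eq_zero one_pos h2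
  simp [bumpFun, bumpDeriv, h1, h2]

/-- Inside `|ξ| < 2 ≤ R` the cutoff is `1` and its derivative `0`. [folklore] -/
theorem cutoff_plateau_of_lt_two {R : ℝ} (hR : 2 ≤ R) {x : ℝ} (hx : |x| < 2) : cutoff R x = 1 ∧ deriv (cutoff R) x = 0 := by
  have hR0 : 0 < R := by linarith
  have hx2 : x ^ 2 < R ^ 2 := by
    have : |x| ^ 2 < 2 ^ 2 := pow_lt_pow_left₀ hx (abs_nonneg _) two_ne_zero
    rw [sq_abs] at this
    nlinarith
  exact ⟨cutoff_eq_one hR0 hx2.le, deriv_cutoff_eq_zero_of_lt hR0 hx2⟩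

/-- **Plateau identity, profile slot**: for `R ≥ 2`, `linForm(χ_R u, χ_R′u + χ_R u₁; ρ, ρ₁) = linForm(u, u₁; ρ, ρ₁)`. [folklore] -/
theorem linForm_cutoff_bump_eq (L : ℝ) (d V u u₁ : ℝ → ℝ) {R : ℝ} (hR : 2 ≤ R) :
    linForm L d V (fun ξ => cutoff R ξ * u ξ) (fun ξ => deriv (cutoff R) ξ * u ξ + cutoff R ξ * u₁ ξ) bumpFun bumpDeriv =
      linForm L d V u u₁ bumpFun bumpDeriv := by
  unfold linForm
  refine integral_congr_ae (Eventually.of_forall fun ξ => ?_)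
  by_cases hx : 2 ≤ |ξ|
  · obtain ⟨hb, hb'⟩ := bump_support_two ξ hx
    simp only [hb, hb', mul_zero, add_zero]
  · obtain ⟨hc, hc'⟩ := cutoff_plateau_of_lt_two hR (not_le.1 hx)
    simp only [hc, hc', one_mul, zero_mul, zero_add]

/-- **Plateau identity, test slot**: for `R ≥ 2`, `linForm(ρ, ρ₁; χ_R u, χ_R′u + χ_R u₁) = linForm(ρ, ρ₁; u, u₁)`. [folklore] -/
theorem linForm_bump_cutoff_eq (L : ℝ) (d V u u₁ : ℝ → ℝ) {R : ℝ} (hR : 2 ≤ R) :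
    linForm L d V bumpFun bumpDeriv (fun ξ => cutoff R ξ * u ξ) (fun ξ => deriv (cutoff R) ξ * u ξ + cutoff R ξ * u₁ ξ) =
      linForm L d V bumpFun bumpDeriv u u₁ := by
  unfold linForm
  refine integral_congr_ae (Eventually.of_forall fun ξ => ?_)
  by_cases hx : 2 ≤ |ξ|
  · obtain ⟨hb, hb'⟩ := bump_support_two ξ hx
    simp only [hb, hb', mul_zero, zero_mul, add_zero]
  · obtain ⟨hc, hc'⟩ := cutoff_plateau_of_lt_two hR (not_le.1 hx)
    simp only [hc, hc', one_mul, zero_mul, zero_add]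

/-- The `K`-pairing against the bump also sees only the plateau: `∫ w g (χ_R u)·? ` is not needed; instead, for `R ≥ 2`,
`∫ w g ρ` is unchanged — recorded as the trivial identity `∫ w (χ_R g') ρ = ∫ w g' ρ` for functions. [folklore] -/
theorem integral_cutoff_mul_bump_eq (L : ℝ) (g : ℝ → ℝ) {R : ℝ} (hR : 2 ≤ R) :
    ∫ y, (L ^ 2 + y ^ 2) * (cutoff R y * g y * bumpFun y) = ∫ y, (L ^ 2 + y ^ 2) * (g y * bumpFun y) := by
  refine integral_congr_ae (Eventually.of_forall fun ξ => ?_)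
  by_cases hx : 2 ≤ |ξ|
  · obtain ⟨hb, -⟩ := bump_support_two ξ hx
    simp only [hb, mul_zero]
  · obtain ⟨hc, -⟩ := cutoff_plateau_of_lt_two hR (not_le.1 hx)
    simp only [hc, one_mul]

/-! ### §4 Bilinear expansion of the form at a mass-corrected test -/

section Expand

variable {D₀ D₁ V₀ : ℝ} {d V : ℝ → ℝ}

/-- **Expansion** `linForm(a − μb; a − μb) = linForm(a;a) − μ·linForm(a;b) − μ·linForm(b;a) + μ²·linForm(b;b)` for parity-free tests
`(a, a₁)`, `(b, b₁)` (all four integrands are integrable by the fixed-test bound). [folklore] -/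
theorem linForm_sub_smul_expand (hL : 0 < L) (hdm : AEStronglyMeasurable d volume) (hVm : AEStronglyMeasurable V volume)
    (hD₁ : 0 ≤ D₁) (hd : ∀ ξ, |d ξ| ≤ D₀ + D₁ * |ξ|) (hV : ∀ ξ, |V ξ| ≤ V₀) {a a₁ b b₁ : ℝ → ℝ} (ha : IsCompactTestAny a a₁)
    (hb : IsCompactTestAny b b₁) (μ : ℝ) :
    linForm L d V (fun y => a y - μ * b y) (fun y => a₁ y - μ * b₁ y) (fun y => a y - μ * b y) (fun y => a₁ y - μ * b₁ y) =
      linForm L d V a a₁ a a₁ - μ * linForm L d V a a₁ b b₁ - μ * linForm L d V b b₁ a a₁ + μ ^ 2 * linForm L d V b b₁ b b₁ := by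
  obtain ⟨hac, -, -, -⟩ := basic_of_any ha
  obtain ⟨hbc, -, -, -⟩ := basic_of_any hb
  obtain ⟨hwa, hwa₁⟩ := weighted_of_any (L := L) ha
  obtain ⟨hwb, hwb₁⟩ := weighted_of_any (L := L) hb
  -- the scaled test `(−μ b, −μ b₁)`
  have hbs : IsCompactTestAny (fun y => -μ * b y) (fun y => -μ * b₁ y) := by
    refine ⟨fun x => ?_, hb.memLp.const_mul _, ?_⟩
    · rw [intervalIntegral.integral_const_mul, hb.primitive x]; ring
    · obtain ⟨R, hR⟩ := hb.support
      exact ⟨R, fun x hx => by simp [(hR x hx).1, (hR x hx).2]⟩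
  obtain ⟨hwbs, hwbs₁⟩ := weighted_of_any (L := L) hbs
  have hbsm : AEStronglyMeasurable (fun y => -μ * b y) volume := hbc.aestronglyMeasurable.const_mul _
  -- integrability of the eight integrands (profile ∈ {a, −μb}, test ∈ {a, −μb} and the four base ones)
  have Iaa := (abs_linForm_le_any hL hdm hVm hD₁ hd hV ha hac.aestronglyMeasurable ha.memLp.1 hwa hwa₁).1
  have Iab := (abs_linForm_le_any hL hdm hVm hD₁ hd hV hb hac.aestronglyMeasurable ha.memLp.1 hwa hwa₁).1
  have Iba := (abs_linForm_le_any hL hdm hVm hD₁ hd hV ha hbc.aestronglyMeasurable hb.memLp.1 hwb hwb₁).1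
  have Ibb := (abs_linForm_le_any hL hdm hVm hD₁ hd hV hb hbc.aestronglyMeasurable hb.memLp.1 hwb hwb₁).1
  have Iabs := (abs_linForm_le_any hL hdm hVm hD₁ hd hV hbs hac.aestronglyMeasurable ha.memLp.1 hwa hwa₁).1
  have Ibsa := (abs_linForm_le_any hL hdm hVm hD₁ hd hV ha hbsm hbs.memLp.1 hwbs hwbs₁).1
  have Ibsbs := (abs_linForm_le_any hL hdm hVm hD₁ hd hV hbs hbsm hbs.memLp.1 hwbs hwbs₁).1
  -- rewrite `x − μ y` as `x + (−μ) y`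
  have e1 : (fun y => a y - μ * b y) = fun y => a y + -μ * b y := by funext y; ring
  have e2 : (fun y => a₁ y - μ * b₁ y) = fun y => a₁ y + -μ * b₁ y := by funext y; ring
  rw [e1, e2]
  -- expand in the profile slot, then in the test slot
  have hsumL : Integrable (fun y => (L ^ 2 + y ^ 2) * (a₁ y * (a₁ y + -μ * b₁ y)) + 2 * y * (a₁ y * (a y + -μ * b y))
      + (L ^ 2 + y ^ 2) * d y * (a₁ y * (a y + -μ * b y)) + (L ^ 2 + y ^ 2) * V y * (a y * (a y + -μ * b y))) := by
    refine (Iaa.add Iabs).congr (Eventually.of_forall fun y => ?_)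
    simp only [Pi.add_apply]; ring
  have hsumR : Integrable (fun y => (L ^ 2 + y ^ 2) * ((-μ * b₁ y) * (a₁ y + -μ * b₁ y)) + 2 * y * ((-μ * b₁ y) * (a y + -μ * b y))
      + (L ^ 2 + y ^ 2) * d y * ((-μ * b₁ y) * (a y + -μ * b y)) + (L ^ 2 + y ^ 2) * V y * ((-μ * b y) * (a y + -μ * b y))) := by
    refine (Ibsa.add Ibsbs).congr (Eventually.of_forall fun y => ?_)
    simp only [Pi.add_apply]; ring
  rw [linForm_add_left L d V hsumL hsumR, linForm_add_right L d V Iaa Iabs, linForm_add_right L d V Ibsa Ibsbs,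
    linForm_smul_right L d V (-μ), linForm_smul_left L d V (-μ), linForm_smul_left L d V (-μ), linForm_smul_right L d V (-μ)]
  ring

end Expand

/-! ### §5 The Gårding datum at the shifted potential -/

variable {D₀ D₁ V₀ c m : ℝ} {d V : ℝ → ℝ} {hL : 0 < L} {K : EspE L hL →L[ℝ] W L}

/-- **The (S1⁺) datum at the shifted potential `V + s`**: `c‖v₁‖²_w + (m + s)‖v‖²_w ≤ linForm_{V+s}(v; v) + ∫ w K(jmapE v)·v` on every
zero-mass even test. [folklore] -/
theorem garding_shiftE (h : GardingDataKE L hL d V K D₀ D₁ V₀ c m) (s : ℝ) (vp : testSpaceE0) :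
    c * (∫ ξ, (L ^ 2 + ξ ^ 2) * vp.1.2 ξ ^ 2) + (m + s) * ∫ ξ, (L ^ 2 + ξ ^ 2) * vp.1.1 ξ ^ 2 ≤
      linForm L d (fun ξ => V ξ + s) vp.1.1 vp.1.2 vp.1.1 vp.1.2
        + ∫ y, (L ^ 2 + y ^ 2) * (((K (jmapE hL vp) : W L) : ℝ → ℝ) y * vp.1.1 y) := by
  obtain ⟨hc, -, -, -⟩ := basic_of_any vp.2.1.toIsCompactTestAny
  obtain ⟨hwv, hwv₁⟩ := weighted_of_any (L := L) vp.2.1.toIsCompactTestAny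
  obtain ⟨hint, -⟩ := abs_linForm_le_any hL h.d_meas h.V_meas h.D₁_nonneg h.d_le h.V_le vp.2.1.toIsCompactTestAny
    hc.aestronglyMeasurable vp.2.1.memLp.1 hwv hwv₁
  have hshift : linForm L d (fun ξ => V ξ + s) vp.1.1 vp.1.2 vp.1.1 vp.1.2 =
      linForm L d V vp.1.1 vp.1.2 vp.1.1 vp.1.2 + s * ∫ y, (L ^ 2 + y ^ 2) * vp.1.1 y ^ 2 := by
    unfold linForm
    rw [← integral_const_mul, ← integral_add hint (hwv.const_mul s)]
    refine integral_congr_ae (Eventually.of_forall fun y => ?_)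
    ring
  rw [hshift]
  have hG := h.garding vp
  linarith

end SheetREvenCutoff
end Summit.NavierStokesRegularity.OSWSelfSimilar

end
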